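import Literature.ComputerArithmetic.Shewchuk1997.ScaleExpansion

/-!
# The witness run against Corollary 22 of Shewchuk (1997): SCALE-EXPANSION on
# `e = ⟨M, 2^(c+2), −2^(c+3)⟩`, `b = 3·2^a + 1` under round-to-even

HONEST FRAMING (ENGINES group, unit `eng-quad-4`, kernels lane of the `certquad` engine — shared
numerical engines serving client cells; rigour lives in the verifiers; every published number
belongs to a client cell's ledger, not to the engines group): this is NEW WORK of the lane's Lean
line, not a published result, hence it lives under `Summits/Ventures/` and carries no citation tag of
its own.  It is the computational half of `ScaleExpansionCounterexample.lean` (same directory), which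
shows that Corollary 22 of [Shewchuk1997] (p. 330: SCALE-EXPANSION preserves the strongly
nonoverlapping property under round-to-even) is false as printed; the split is by topic only.

WHAT IS COMPUTED.  Precision `p = a + 2` (`a ≥ 1`), `c ∈ {a, a + 1}` with `3M + 1 = 2^(c+2)` for an
integer `M` (so `c + 2` is even and `M = (2^(c+2) − 1)/3`), `b = 3·2^a + 1`, exponent floor
`emin ≤ 0`, rounding `roundTiesEven (a + 2) emin` of [BoldoEtAl2023], and ANY two-product routine `tp`
returning `(x ⊗ b, xb − x ⊗ b)` on the three operands.  Then (`scaleExpansion_ce2`)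
`scaleExpansion tp (roundTiesEven (a+2) emin) [M, 2^(c+2), −2^(c+3)] b
   = [M − 2^a, 0, 2^(c+2), 0, 0, −2^(c+3)·(2^a + 1)]`:
Line 1 rounds `Mb = 2^(c+a+2) + (M − 2^a)` DOWN to `2^(c+a+2)` (`0 < M − 2^a < 2^c = ulp/2`,
`fl_ce2_prod`); at `i = 2` the sum `2^(c+2)b + 2^(c+a+2) = 2^(c+a+4) + 2^(c+2)` is an exact TIE of the
binade `[2^(c+a+4), 2^(c+a+5))` (`ulp = 2^(c+3)`) and goes to the EVEN side `2^(c+a+4)`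
(`roundTiesEven_ce2_tie`), leaving the roundoff `h₃ = 2^(c+2)`; at `i = 3` everything is exact and the
last component is `h₆ = −2^(c+3)b + 2^(c+a+4) = −2^(c+3)(2^a + 1)`.  Also: the operands are `p`-bit
floats (`ce2E_isFloat`, `ce2b_isFloat`), size facts on `M` (`ce2_bounds`), and the closed form of the
six output slots of SCALE-EXPANSION on a three-component input (`scaleExpansion_three`, by `rfl`).

PROVED HERE (0 sorry, no new definitions): `ce2_bounds`, `ce2_prod`, `fl_ce2_prod`,
`roundTiesEven_ce2_tie`, `scaleExpansion_three`, `isFloat_int_mul_pow`, `scaleExpansion_ce2`,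
`ce2E_isFloat`, `ce2b_abs_lt`, `ce2b_isFloat`.

References: [Shewchuk1997] Fig. 13 and Thm 19 p. 328 (the algorithm, typed as `scaleExpansion` in
`Literature/ComputerArithmetic/Shewchuk1997/ScaleExpansion.lean`), Cor. 22 p. 330 (refuted next door).
-/

namespace Summit.Ventures.CertifiedArithmetic.Expansions

open Literature.ComputerArithmetic.JeannerodRump2018 (IsFloat IsRoundNearest isFloat_zero)
open Literature.ComputerArithmetic.BoldoJeannerodMelquiondMuller2023 (roundTiesEven ulp ulp_of_ne_zero
  isRoundNearest_roundTiesEven roundTiesEven_of_tie roundTiesEven_eq_self fl_eq_of_abs_sub_lt_half_ulp)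
open Literature.ComputerArithmetic.Shewchuk1997

/-! ### The parameters

Precision `p = a + 2` with `a ≥ 1`; the exponent `c ∈ {a, a + 1}` for which `c + 2` is the EVEN
member of `{p, p + 1}`; the integer `M = (2^(c+2) − 1)/3` (binary `101…01`, a `p`-bit float since
`M < 2^(a+2)`); the scaling float `b = 3·2^a + 1 = 3·2^(p−2) + 1`; the input expansion
`e = ⟨M, 2^(c+2), −2^(c+3)⟩` (increasing magnitude). -/

/-- Size facts about `M = (2^(c+2) − 1)/3`: `2^a < M < 2^a + 2^c`, so `0 < M < 2^(a+2)` and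
`2M < 2^(c+2)`. -/
theorem ce2_bounds {a c : ℕ} (ha : 1 ≤ a) (hca : a ≤ c) (hc : c ≤ a + 1) {M : ℤ}
    (hM : 3 * M + 1 = 2 ^ (c + 2)) :
    (2 : ℤ) ^ a < M ∧ M < 2 ^ a + 2 ^ c ∧ 0 < M ∧ M < 2 ^ (a + 2) ∧ 2 * M < 2 ^ (c + 2) := by
  have h2a : (2 : ℤ) ≤ 2 ^ a := by
    calc (2 : ℤ) = 2 ^ 1 := by norm_num
      _ ≤ 2 ^ a := pow_le_pow_right₀ (by norm_num) ha
  have hac : (2 : ℤ) ^ a ≤ 2 ^ c := pow_le_pow_right₀ (by norm_num) hca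
  have hca' : (2 : ℤ) ^ c ≤ 2 ^ (a + 1) := pow_le_pow_right₀ (by norm_num) hc
  have e1 : (2 : ℤ) ^ (a + 1) = 2 * 2 ^ a := by ring
  have e2 : (2 : ℤ) ^ (c + 2) = 4 * 2 ^ c := by ring
  have e3 : (2 : ℤ) ^ (a + 2) = 4 * 2 ^ a := by ring
  rw [e1] at hca'
  rw [e2] at hM
  refine ⟨by linarith, by linarith, by linarith, by rw [e3]; linarith, by rw [e2]; linarith⟩

/-- The product `M·b = M(3·2^a + 1) = 2^(c+a+2) + (M − 2^a)`. -/
theorem ce2_prod {a c : ℕ} {M : ℤ} (hM : 3 * M + 1 = 2 ^ (c + 2)) :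
    ((M : ℚ) * (3 * 2 ^ a + 1)) = 2 ^ (c + a + 2) + ((M : ℚ) - 2 ^ a) := by
  have hMq : 3 * (M : ℚ) + 1 = 2 ^ (c + 2) := by exact_mod_cast hM
  have : (2 : ℚ) ^ (c + a + 2) = 2 ^ (c + 2) * 2 ^ a := by ring
  rw [this, ← hMq]; ring

/-- `RN(M·b) = 2^(c+a+2)` for ANY round-to-nearest: `M·b` exceeds the float `2^(c+a+2)` by
`M − 2^a < 2^c = ½ulp`. -/
theorem fl_ce2_prod {a c : ℕ} (ha : 1 ≤ a) (hca : a ≤ c) (hc : c ≤ a + 1) {M : ℤ}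
    (hM : 3 * M + 1 = 2 ^ (c + 2)) {emin : ℤ} (hemin : emin ≤ 0) {fl : ℚ → ℚ}
    (hfl : IsRoundNearest (a + 2) emin fl) :
    fl ((M : ℚ) * (3 * 2 ^ a + 1)) = 2 ^ (c + a + 2) := by
  obtain ⟨hlo, hhi, hM0, -, -⟩ := ce2_bounds ha hca hc hM
  have hloq : (2 : ℚ) ^ a < M := by exact_mod_cast hlo
  have hhiq : (M : ℚ) < 2 ^ a + 2 ^ c := by exact_mod_cast hhi
  have hp : 1 ≤ a + 2 := by omega
  set x : ℚ := (M : ℚ) * (3 * 2 ^ a + 1) with hx_def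
  have hx : x = 2 ^ (c + a + 2) + ((M : ℚ) - 2 ^ a) := ce2_prod hM
  have h2c : (2 : ℚ) ^ c ≤ 2 ^ (c + a + 2) := pow_le_pow_right₀ (by norm_num) (by omega)
  have hxpos : 0 < x := by rw [hx]; linarith
  have hx0 : x ≠ 0 := hxpos.ne'
  have hpos : 0 < |x| := abs_pos.mpr hx0
  have habs : |x| = x := abs_of_pos hxpos
  have h2 : (2 : ℚ) ≠ 0 := by norm_num
  have hlog : Int.log 2 |x| = (c : ℤ) + a + 2 := by
    apply le_antisymm
    · have hlt : |x| < ((2 : ℕ) : ℚ) ^ ((c : ℤ) + a + 2 + 1) := by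
        rw [habs, hx, Nat.cast_ofNat, show (c : ℤ) + a + 2 + 1 = ((c + a + 3 : ℕ) : ℤ) by push_cast; ring,
          zpow_natCast, show (2 : ℚ) ^ (c + a + 3) = 2 ^ (c + a + 2) + 2 ^ (c + a + 2) by ring]
        linarith
      have := (Int.lt_zpow_iff_log_lt (b := 2) (by norm_num) hpos).mp hlt
      omega
    · have hle : ((2 : ℕ) : ℚ) ^ ((c : ℤ) + a + 2) ≤ |x| := by
        rw [habs, hx, Nat.cast_ofNat, show (c : ℤ) + a + 2 = ((c + a + 2 : ℕ) : ℤ) by push_cast; ring,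
          zpow_natCast]
        linarith
      exact (Int.zpow_le_iff_le_log (b := 2) (by norm_num) hpos).mp hle
  have hu : ulp (a + 2) emin x = 2 ^ (c + 1) := by
    rw [ulp_of_ne_zero hx0, hlog]
    have : (c : ℤ) + a + 2 - ((a + 2 : ℕ) : ℤ) + 1 = ((c + 1 : ℕ) : ℤ) := by push_cast; ring
    rw [this, max_eq_right (by omega), zpow_natCast]
  have hF : IsFloat (a + 2) emin ((2 : ℚ) ^ (c + a + 2)) :=
    ⟨1, (c : ℤ) + a + 2, by
      rw [abs_one]; exact one_lt_pow₀ (by norm_num) (by omega), by omega, by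
      rw [show (c : ℤ) + a + 2 = ((c + a + 2 : ℕ) : ℤ) by push_cast; ring, zpow_natCast]; simp⟩
  apply fl_eq_of_abs_sub_lt_half_ulp hp hfl hF
  rw [hu, hx, show (2 : ℚ) ^ (c + a + 2) + ((M : ℚ) - 2 ^ a) - 2 ^ (c + a + 2) = (M : ℚ) - 2 ^ a by ring,
    abs_of_pos (by linarith), show (2 : ℚ) ^ (c + 1) / 2 = 2 ^ c by rw [pow_succ]; ring]
  linarith

/-- THE TIE.  `T₂ ⊕ Q₃ = RNₑ(2^(c+2)·b + 2^(c+a+2)) = RNₑ(2^(c+a+4) + 2^(c+2))`: the argument lies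
exactly halfway between the consecutive `p`-bit floats `2^(c+a+4)` and `2^(c+a+4) + 2^(c+3)`
(`ulp = 2^(c+3)`), and round-to-even picks the even significand `2^(a+1)`: the result is `2^(c+a+4)`
and the FAST-TWO-SUM roundoff is `h₃ = 2^(c+2)`. -/
theorem roundTiesEven_ce2_tie (a c : ℕ) {emin : ℤ} (hemin : emin ≤ 0) :
    roundTiesEven (a + 2) emin (2 ^ (c + a + 4) + 2 ^ (c + 2)) = 2 ^ (c + a + 4) := by
  set x : ℚ := 2 ^ (c + a + 4) + 2 ^ (c + 2) with hx_def
  have h2c : (0 : ℚ) < 2 ^ (c + 2) := by positivity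
  have h2ca : (0 : ℚ) < 2 ^ (c + a + 4) := by positivity
  have hle4 : (2 : ℚ) ^ (c + 2) < 2 ^ (c + a + 4) := pow_lt_pow_right₀ (by norm_num) (by omega)
  have hxpos : 0 < x := by positivity
  have hx0 : x ≠ 0 := hxpos.ne'
  have hpos : 0 < |x| := abs_pos.mpr hx0
  have habs : |x| = x := abs_of_pos hxpos
  have hlog : Int.log 2 |x| = (c : ℤ) + a + 4 := by
    apply le_antisymm
    · have hlt : |x| < ((2 : ℕ) : ℚ) ^ ((c : ℤ) + a + 4 + 1) := by
        rw [habs, hx_def, Nat.cast_ofNat,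
          show (c : ℤ) + a + 4 + 1 = ((c + a + 5 : ℕ) : ℤ) by push_cast; ring, zpow_natCast,
          show (2 : ℚ) ^ (c + a + 5) = 2 ^ (c + a + 4) + 2 ^ (c + a + 4) by ring]
        linarith
      have := (Int.lt_zpow_iff_log_lt (b := 2) (by norm_num) hpos).mp hlt
      omega
    · have hle : ((2 : ℕ) : ℚ) ^ ((c : ℤ) + a + 4) ≤ |x| := by
        rw [habs, hx_def, Nat.cast_ofNat,
          show (c : ℤ) + a + 4 = ((c + a + 4 : ℕ) : ℤ) by push_cast; ring, zpow_natCast]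
        linarith
      exact (Int.zpow_le_iff_le_log (b := 2) (by norm_num) hpos).mp hle
  have hu : ulp (a + 2) emin x = 2 ^ (c + 3) := by
    rw [ulp_of_ne_zero hx0, hlog]
    have : (c : ℤ) + a + 4 - ((a + 2 : ℕ) : ℤ) + 1 = ((c + 3 : ℕ) : ℤ) := by push_cast; ring
    rw [this, max_eq_right (by omega), zpow_natCast]
  have hN : ⌊x / 2 ^ (c + 3)⌋ = (2 : ℤ) ^ (a + 1) := by
    rw [Int.floor_eq_iff]
    have hq : x / 2 ^ (c + 3) = 2 ^ (a + 1) + 1 / 2 := by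
      rw [hx_def, div_eq_iff (by positivity)]; ring
    rw [hq]; push_cast; constructor <;> linarith
  have htie : x - (⌊x / ulp (a + 2) emin x⌋ : ℚ) * ulp (a + 2) emin x =
      ((⌊x / ulp (a + 2) emin x⌋ : ℚ) + 1) * ulp (a + 2) emin x - x := by
    rw [hu, hN, hx_def]; push_cast; ring
  have heven : Even ⌊x / ulp (a + 2) emin x⌋ := by
    rw [hu, hN]; exact ⟨2 ^ a, by ring⟩
  rw [roundTiesEven_of_tie htie, if_pos heven, hu, hN]; push_cast; ring


/-! ### The run of SCALE-EXPANSION on `e = ⟨M, 2^(c+2), −2^(c+3)⟩`, `b = 3·2^a + 1` -/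

/-- SCALE-EXPANSION on a three-component expansion, unrolled (Lines 1–6 of Fig. 13). -/
theorem scaleExpansion_three (tp : ℚ → ℚ → ℚ × ℚ) (fl : ℚ → ℚ) (x y z b : ℚ) :
    scaleExpansion tp fl [x, y, z] b =
      [(tp x b).2,
        (twoSum fl (tp x b).1 (tp y b).2).2,
        (fastTwoSum fl (tp y b).1 (twoSum fl (tp x b).1 (tp y b).2).1).2,
        (twoSum fl (fastTwoSum fl (tp y b).1 (twoSum fl (tp x b).1 (tp y b).2).1).1 (tp z b).2).2,
        (fastTwoSum fl (tp z b).1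
          (twoSum fl (fastTwoSum fl (tp y b).1 (twoSum fl (tp x b).1 (tp y b).2).1).1 (tp z b).2).1).2,
        (fastTwoSum fl (tp z b).1
          (twoSum fl (fastTwoSum fl (tp y b).1 (twoSum fl (tp x b).1 (tp y b).2).1).1
            (tp z b).2).1).1] := rfl

/-- A number `K·2^n` with `|K| < 2^p` and `n ≥ 0 ≥ emin` is a `p`-bit float. -/
theorem isFloat_int_mul_pow {p : ℕ} {emin : ℤ} (hemin : emin ≤ 0) {K : ℤ} (hK : |K| < 2 ^ p)
    (n : ℕ) : IsFloat p emin ((K : ℚ) * 2 ^ n) :=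
  ⟨K, n, hK, by omega, by rw [zpow_natCast]⟩

/-- THE RUN (precision `p = a + 2`, round-to-even, `emin ≤ 0`, ANY two-product returning
`(eᵢ ⊗ b, eᵢb − eᵢ ⊗ b)` on the three operands — Dekker's, an FMA's, …):
SCALE-EXPANSION(`⟨M, 2^(c+2), −2^(c+3)⟩`, `3·2^a + 1`) `= ⟨M − 2^a, 0, 2^(c+2), 0, 0, −2^(c+3)·(2^a + 1)⟩`.
Line 1: `Q₂ = 2^(c+a+2)`, `h₁ = M − 2^a`; `i = 2`: `T₂ = 2^(c+2)·b` exactly, `t₂ = 0`, so `Q₃ = Q₂`,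
`h₂ = 0`, and `T₂ ⊕ Q₃` is the tie: `Q₄ = 2^(c+a+4)`, `h₃ = 2^(c+2)`; `i = 3`: `T₃ = −2^(c+3)·b`
exactly, `t₃ = 0`, `Q₅ = Q₄`, `h₄ = 0`, `T₃ + Q₅ = −2^(c+3)·(2^a + 1)` is a float, so `h₅ = 0` and
`h₆ = Q₆ = −2^(c+3)·(2^a + 1)`. -/
theorem scaleExpansion_ce2 {a c : ℕ} (ha : 1 ≤ a) (hca : a ≤ c) (hc : c ≤ a + 1) {M : ℤ}
    (hM : 3 * M + 1 = 2 ^ (c + 2)) {emin : ℤ} (hemin : emin ≤ 0) {tp : ℚ → ℚ → ℚ × ℚ}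
    (htp : ∀ x ∈ [(M : ℚ), 2 ^ (c + 2), -2 ^ (c + 3)],
      (tp x (3 * 2 ^ a + 1)).1 = roundTiesEven (a + 2) emin (x * (3 * 2 ^ a + 1)) ∧
        (tp x (3 * 2 ^ a + 1)).1 + (tp x (3 * 2 ^ a + 1)).2 = x * (3 * 2 ^ a + 1)) :
    scaleExpansion tp (roundTiesEven (a + 2) emin) [(M : ℚ), 2 ^ (c + 2), -2 ^ (c + 3)]
        (3 * 2 ^ a + 1) =
      [(M : ℚ) - 2 ^ a, 0, 2 ^ (c + 2), 0, 0, -(2 ^ (c + 3) * (2 ^ a + 1))] := by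
  have hp : 1 ≤ a + 2 := by omega
  have hR := isRoundNearest_roundTiesEven (p := a + 2) (emin := emin) hp
  obtain ⟨hlo, hhi, hM0, hM4, -⟩ := ce2_bounds ha hca hc hM
  have h2a : (2 : ℤ) ≤ 2 ^ a := by
    calc (2 : ℤ) = 2 ^ 1 := by norm_num
      _ ≤ 2 ^ a := pow_le_pow_right₀ (by norm_num) ha
  have e3 : (2 : ℤ) ^ (a + 2) = 4 * 2 ^ a := by ring
  -- the floats at hand
  have hbF : IsFloat (a + 2) emin (3 * 2 ^ a + 1 : ℚ) := by
    have h := isFloat_int_mul_pow (p := a + 2) hemin (K := 3 * 2 ^ a + 1)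
      (by rw [abs_of_pos (by positivity), e3]; linarith) 0
    simpa using h
  have hMF : IsFloat (a + 2) emin (M : ℚ) := by
    have h := isFloat_int_mul_pow (p := a + 2) hemin (K := M) (by rw [abs_of_pos hM0]; exact hM4) 0
    simpa using h
  have hNF : IsFloat (a + 2) emin ((2 : ℚ) ^ (c + a + 2)) := by
    have h := isFloat_int_mul_pow (p := a + 2) hemin (K := 1)
      (by rw [abs_one]; exact one_lt_pow₀ (by norm_num) (by omega)) (c + a + 2)
    simpa using h
  have hQ4F : IsFloat (a + 2) emin ((2 : ℚ) ^ (c + a + 4)) := by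
    have h := isFloat_int_mul_pow (p := a + 2) hemin (K := 1)
      (by rw [abs_one]; exact one_lt_pow₀ (by norm_num) (by omega)) (c + a + 4)
    simpa using h
  have hT2F : IsFloat (a + 2) emin ((2 : ℚ) ^ (c + 2) * (3 * 2 ^ a + 1)) := by
    have h := isFloat_int_mul_pow (p := a + 2) hemin (K := 3 * 2 ^ a + 1)
      (by rw [abs_of_pos (by positivity), e3]; linarith) (c + 2)
    have e : ((3 * 2 ^ a + 1 : ℤ) : ℚ) * 2 ^ (c + 2) = 2 ^ (c + 2) * (3 * 2 ^ a + 1) := by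
      push_cast; ring
    rwa [e] at h
  have hT3F : IsFloat (a + 2) emin ((-2 ^ (c + 3) : ℚ) * (3 * 2 ^ a + 1)) := by
    have h := isFloat_int_mul_pow (p := a + 2) hemin (K := -(3 * 2 ^ a + 1))
      (by rw [abs_neg, abs_of_pos (by positivity), e3]; linarith) (c + 3)
    have e : ((-(3 * 2 ^ a + 1) : ℤ) : ℚ) * 2 ^ (c + 3) = (-2 ^ (c + 3) : ℚ) * (3 * 2 ^ a + 1) := by
      push_cast; ring
    rwa [e] at h
  have hH6F : IsFloat (a + 2) emin (-(2 ^ (c + 3) * (2 ^ a + 1)) : ℚ) := by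
    have h := isFloat_int_mul_pow (p := a + 2) hemin (K := -(2 ^ a + 1))
      (by rw [abs_neg, abs_of_pos (by positivity), e3]; linarith) (c + 3)
    have e : ((-(2 ^ a + 1) : ℤ) : ℚ) * 2 ^ (c + 3) = (-(2 ^ (c + 3) * (2 ^ a + 1)) : ℚ) := by
      push_cast; ring
    rwa [e] at h
  -- the three two-products
  obtain ⟨h11, h12⟩ := htp (M : ℚ) (by simp)
  obtain ⟨h21, h22⟩ := htp (2 ^ (c + 2)) (by simp)
  obtain ⟨h31, h32⟩ := htp (-2 ^ (c + 3)) (by simp)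
  rw [fl_ce2_prod ha hca hc hM hemin hR] at h11
  have h12' : (tp (M : ℚ) (3 * 2 ^ a + 1)).2 = (M : ℚ) - 2 ^ a := by
    rw [h11, ce2_prod hM] at h12; linarith
  rw [roundTiesEven_eq_self hp hT2F] at h21
  have h22' : (tp (2 ^ (c + 2)) (3 * 2 ^ a + 1)).2 = 0 := by rw [h21] at h22; linarith
  rw [roundTiesEven_eq_self hp hT3F] at h31
  have h32' : (tp (-2 ^ (c + 3)) (3 * 2 ^ a + 1)).2 = 0 := by rw [h31] at h32; linarith
  rw [scaleExpansion_three, h12', h11, h21, h22', h31, h32']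
  -- `TWO-SUM(Q₂, 0)`
  have hs1 : (twoSum (roundTiesEven (a + 2) emin) ((2 : ℚ) ^ (c + a + 2)) 0).1 = 2 ^ (c + a + 2) := by
    rw [twoSum_fst, add_zero, roundTiesEven_eq_self hp hNF]
  have hs2 : (twoSum (roundTiesEven (a + 2) emin) ((2 : ℚ) ^ (c + a + 2)) 0).2 = 0 := by
    rw [(twoSum_exact hp hR hNF (isFloat_zero _ _)).1, add_zero, roundTiesEven_eq_self hp hNF, sub_self]
  rw [hs1, hs2]
  -- `FAST-TWO-SUM(T₂, Q₃)`: the tie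
  have eT2 : (2 : ℚ) ^ (c + 2) * (3 * 2 ^ a + 1) = 3 * 2 ^ (c + a + 2) + 2 ^ (c + 2) := by ring
  have hle1 : |(2 : ℚ) ^ (c + a + 2)| ≤ |(2 : ℚ) ^ (c + 2) * (3 * 2 ^ a + 1)| := by
    rw [abs_of_pos (by positivity), abs_of_pos (by positivity), eT2]
    have : (0 : ℚ) ≤ 2 ^ (c + a + 2) := by positivity
    have : (0 : ℚ) ≤ 2 ^ (c + 2) := by positivity
    linarith
  obtain ⟨hf1, -, hf2, -⟩ := fastTwoSum_exact hp hR hT2F hNF hle1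
  have hsum1 : (2 : ℚ) ^ (c + 2) * (3 * 2 ^ a + 1) + 2 ^ (c + a + 2) = 2 ^ (c + a + 4) + 2 ^ (c + 2) := by
    ring
  rw [hsum1, roundTiesEven_ce2_tie a c hemin] at hf1 hf2
  rw [hf1, hf2]
  -- `TWO-SUM(Q₄, 0)`
  have hs3 : (twoSum (roundTiesEven (a + 2) emin) ((2 : ℚ) ^ (c + a + 4)) 0).1 = 2 ^ (c + a + 4) := by
    rw [twoSum_fst, add_zero, roundTiesEven_eq_self hp hQ4F]
  have hs4 : (twoSum (roundTiesEven (a + 2) emin) ((2 : ℚ) ^ (c + a + 4)) 0).2 = 0 := by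
    rw [(twoSum_exact hp hR hQ4F (isFloat_zero _ _)).1, add_zero, roundTiesEven_eq_self hp hQ4F,
      sub_self]
  rw [hs3, hs4]
  -- `FAST-TWO-SUM(T₃, Q₅)`: exact
  have eT3 : (-2 ^ (c + 3) : ℚ) * (3 * 2 ^ a + 1) = -(6 * 2 ^ (c + a + 2) + 2 ^ (c + 3)) := by ring
  have hle2 : |(2 : ℚ) ^ (c + a + 4)| ≤ |(-2 ^ (c + 3) : ℚ) * (3 * 2 ^ a + 1)| := by
    rw [abs_of_pos (by positivity), eT3, abs_neg, abs_of_pos (by positivity),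
      show (2 : ℚ) ^ (c + a + 4) = 4 * 2 ^ (c + a + 2) by ring]
    have : (0 : ℚ) ≤ 2 ^ (c + a + 2) := by positivity
    have : (0 : ℚ) ≤ 2 ^ (c + 3) := by positivity
    linarith
  obtain ⟨hg1, -, hg2, -⟩ := fastTwoSum_exact hp hR hT3F hQ4F hle2
  have hsum2 : (-2 ^ (c + 3) : ℚ) * (3 * 2 ^ a + 1) + 2 ^ (c + a + 4) = -(2 ^ (c + 3) * (2 ^ a + 1)) := by
    ring
  rw [hsum2, roundTiesEven_eq_self hp hH6F] at hg1 hg2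
  rw [hg1, hg2]
  have e1 : (2 : ℚ) ^ (c + a + 4) + 2 ^ (c + 2) - 2 ^ (c + a + 4) = 2 ^ (c + 2) := by ring
  have e2 : (-(2 ^ (c + 3) * (2 ^ a + 1)) - -(2 ^ (c + 3) * (2 ^ a + 1)) : ℚ) = 0 := by ring
  rw [e1, e2]


/-! ### The operands are floats -/

/-- The components of `e = ⟨M, 2^(c+2), −2^(c+3)⟩` are `p`-bit floats. -/
theorem ce2E_isFloat {a c : ℕ} (ha : 1 ≤ a) (hca : a ≤ c) (hc : c ≤ a + 1) {M : ℤ}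
    (hM : 3 * M + 1 = 2 ^ (c + 2)) {emin : ℤ} (hemin : emin ≤ 0) :
    ∀ x ∈ [(M : ℚ), 2 ^ (c + 2), -2 ^ (c + 3)], IsFloat (a + 2) emin x := by
  obtain ⟨-, -, hM0, hM4, -⟩ := ce2_bounds ha hca hc hM
  have h1 : |(1 : ℤ)| < 2 ^ (a + 2) := by rw [abs_one]; exact one_lt_pow₀ (by norm_num) (by omega)
  intro x hx
  simp only [List.mem_cons, List.not_mem_nil, or_false] at hx
  rcases hx with rfl | rfl | rfl
  · simpa using isFloat_int_mul_pow (p := a + 2) hemin (K := M) (by rw [abs_of_pos hM0]; exact hM4) 0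
  · simpa using isFloat_int_mul_pow (p := a + 2) hemin h1 (c + 2)
  · simpa using (isFloat_int_mul_pow (p := a + 2) hemin h1 (c + 3)).neg

/-- The scaling factor `b = 3·2^a + 1 = 3·2^(p−2) + 1` is a `p`-bit float (an odd integer `< 2^p`). -/
theorem ce2b_abs_lt {a : ℕ} (ha : 1 ≤ a) : |(3 * 2 ^ a + 1 : ℤ)| < 2 ^ (a + 2) := by
  rw [abs_of_pos (by positivity), show (2 : ℤ) ^ (a + 2) = 4 * 2 ^ a by ring]
  have : (2 : ℤ) ≤ 2 ^ a := by
    calc (2 : ℤ) = 2 ^ 1 := by norm_num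
      _ ≤ 2 ^ a := pow_le_pow_right₀ (by norm_num) ha
  linarith

/-- `b = 3·2^a + 1` is a `p`-bit float. -/
theorem ce2b_isFloat {a : ℕ} (ha : 1 ≤ a) {emin : ℤ} (hemin : emin ≤ 0) :
    IsFloat (a + 2) emin (3 * 2 ^ a + 1 : ℚ) := by
  simpa using isFloat_int_mul_pow (p := a + 2) hemin (ce2b_abs_lt ha) 0

end Summit.Ventures.CertifiedArithmetic.Expansions
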